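import Literature.NumberTheory.EllipticCurves.DeShalit1987.RayClassTowerDiagonalSplit
import HarnessLib

/-!
# de Shalit II.4.12 (ii) / II.4.14 Step 1 / II.4.16: a CHAIN OF MODULI `𝔣_{k+1} = 𝔣_k·𝔩_k` running through
# `S ∪ {𝔭̄}` round-robin, started at `𝔤𝔭̄²` — the chain the two-variable measure is glued along, with EVERY
# bookkeeping clause its consumers ask for

De Shalit glues the one-variable measures `μ(𝔣)` along the compatible system of moduli `𝔣 ∣ 𝔣'`
(II.4.12 (ii): one prime `𝔩 ∣ 𝔣` at a time, II.2.5 (i)), for `𝔣` running through the multiples of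
`𝔤 = ∏_{w∈S} w` by powers of `𝔤𝔭̄` (II.4.14 Step 1, II.4.16: `𝒢 = Gal(K(𝔤𝔭̄^∞𝔭^∞)/K)`).  The cell's
two-variable measure (`…EllipticUnitsTwoVariableMeasureSteps`, `…TwoVariableMeasureDischargedSteps`) is built
along an ARBITRARY one-prime-step chain `𝔣 : ℕ → Ideal (𝓞 K)`, `𝔣 (k+1) = 𝔣 k * (𝔩 k).asIdeal`,
`(𝔩 k).asIdeal ∣ 𝔣 k`, of the shape `𝔣 k = 𝔪c k * v̄^(b k + 1)` with `1 ≤ b k`, `v ∤ 𝔪c k`, `v̄ ∤ 𝔪c k`;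
and the endpoint's tower clause `⋂_n U_n ⊆ rayKer K p S` (`RayClassTowerDiagonalSplit`) needs the chain to
be COFINAL with the powers of `𝔤v̄` (every prime of `S ∪ {v̄}` stepped infinitely often) and SUPPORTED on
`S ∪ {v̄}`.  This file SUPPLIES such a chain, once and for all, by an existential statement (no new
definition): the round-robin chain through `insert v̄ S` started at `𝔤·v̄²` (the start `v̄²` rather than `v̄`
makes `w_{𝔣_0} = 1` available from `w_{v̄²} = 1`, gap G3 of the assembly census).

* §1 (private) `exists_roundRobin` — a sequence through a nonempty finset visiting every element infinitely often.
* §2 `not_prod_le_of_forall_ne` — a finite product of primes `≠ v` is not contained in `v`.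
* §3 ★★ `exists_roundRobin_chain` — **the chain**: `∃ 𝔣 𝔩 𝔪c b` with `𝔣 0 = 𝔤·v̄²`, `𝔣 (k+1) = 𝔣 k * (𝔩 k)`,
  `(𝔩 k) ∣ 𝔣 k`, `𝔣 k = 𝔪c k * v̄^(b k + 1)`, `1 ≤ b k`, `v ∤ 𝔪c k`, `v̄ ∤ 𝔪c k`, `𝔣 k ≠ ⊥`, `𝔣 (k+1) ≤ 𝔣 k`,
  `𝔩 k = v̄ ∨ 𝔩 k ∈ S`, every `w ∈ S ∪ {v̄}` equal to `𝔩 k` for `k` beyond every bound, and the two tower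
  hypotheses `∀ m, ∃ n, 𝔣 n ≤ (𝔤v̄)^m` (cofinality) and `∀ M, ∃ k, (𝔤v̄)^k ≤ 𝔣 M` (support).

THEOREMS ONLY (no `def`, no named fact, no `sorry`, no instance).  Cell `bsd-print-cf2`, width
`bsd-line-cf2-p1-w5` g16, piece CS ("chain supply") of the (e)-assembly of the R3 endpoint of print leaf 24720.
Nothing is closed by this file; BSD is not proved by any of this.

## References
* [deShalit1987] E. de Shalit, *Iwasawa theory of elliptic curves with complex multiplication* (1987),
  II.4.12 (ii) and Remark (i) (p. 66–67), II.4.14 Step 1 (p. 71), II.4.16 (p. 76), II.2.5 (i) (p. 50).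
-/

noncomputable section

open scoped NumberField Classical
open NumberField IsDedekindDomain

namespace Literature.NumberTheory.EllipticCurves

namespace DeShalit1987

/-! ### §1. Round robin through a finite set -/

/-- **A sequence through a nonempty finite set visiting every element beyond every bound** (`k ↦` the
`(k mod |T|)`-th element; plumbing for `exists_roundRobin_chain`). [folklore] -/
private theorem exists_roundRobin {α : Type*} (T : Finset α) (hT : T.Nonempty) :
    ∃ f : ℕ → α, (∀ k, f k ∈ T) ∧ ∀ a ∈ T, ∀ N : ℕ, ∃ k, N ≤ k ∧ f k = a := by
  have hc : 0 < T.card := Finset.card_pos.mpr hT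
  refine ⟨fun k ↦ (T.equivFin.symm ⟨k % T.card, Nat.mod_lt k hc⟩ : T), fun k ↦ (T.equivFin.symm _).2,
    fun a ha N ↦ ⟨(T.equivFin ⟨a, ha⟩ : ℕ) + T.card * N, ?_, ?_⟩⟩
  · calc N ≤ T.card * N := Nat.le_mul_of_pos_left N hc
      _ ≤ (T.equivFin ⟨a, ha⟩ : ℕ) + T.card * N := Nat.le_add_left _ _
  · have key : T.equivFin.symm ⟨((T.equivFin ⟨a, ha⟩ : ℕ) + T.card * N) % T.card,
        Nat.mod_lt _ hc⟩ = ⟨a, ha⟩ := by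
      rw [Equiv.symm_apply_eq]
      exact Fin.ext (show ((T.equivFin ⟨a, ha⟩ : ℕ) + T.card * N) % T.card = (T.equivFin ⟨a, ha⟩ : ℕ) by
        rw [Nat.add_mul_mod_self_left, Nat.mod_eq_of_lt (T.equivFin ⟨a, ha⟩).2])
    exact congrArg Subtype.val key

/-! ### §2. Products of primes away from a prime -/

variable {K : Type} [Field K] [NumberField K]

/-- A finite product of nonzero primes all different from `v` is not contained in `v` (nonzero primes of the
Dedekind domain `𝓞 K` are maximal, and a prime containing a product contains a factor).
[cite: NeukirchANT1999, Ch. I §3 Thm. (3.1) and Cor. (3.9)] -/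
theorem not_prod_le_of_forall_ne {ι : Type*} (s : Finset ι) (f : ι → HeightOneSpectrum (𝓞 K))
    {v : HeightOneSpectrum (𝓞 K)} (h : ∀ i ∈ s, f i ≠ v) :
    ¬ ∏ i ∈ s, (f i).asIdeal ≤ v.asIdeal := by
  intro hle
  obtain ⟨i, hi, hiv⟩ := (v.isPrime.prod_le (s := s) (f := fun i ↦ (f i).asIdeal)).mp hle
  exact h i hi (HeightOneSpectrum.ext ((f i).isMaximal.eq_of_le v.isPrime.ne_top hiv))

/-- A nonzero prime different from `v` is not contained in `v` (nonzero primes of `𝓞 K` are maximal).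
[cite: NeukirchANT1999, Ch. I §3 Thm. (3.1)] -/
theorem not_asIdeal_le_of_ne {w v : HeightOneSpectrum (𝓞 K)} (h : w ≠ v) : ¬ w.asIdeal ≤ v.asIdeal :=
  fun hle ↦ h (HeightOneSpectrum.ext (w.isMaximal.eq_of_le v.isPrime.ne_top hle))

/-! ### §3. The chain -/

/-- ★★ **THE ROUND-ROBIN CHAIN OF MODULI through `S ∪ {v̄}`, started at `𝔤·v̄²`** (`𝔤 = ∏_{w∈S} w`; `v ∉ S`,
`v̄ ∉ S`, `v̄ ≠ v`).  There exist `𝔣 : ℕ → Ideal (𝓞 K)`, steps `𝔩 : ℕ → primes`, and the decomposition data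
`𝔪c : ℕ → Ideal (𝓞 K)`, `b : ℕ → ℕ` with:
`𝔣 0 = 𝔤·v̄²`; `𝔣 (k+1) = 𝔣 k · 𝔩 k`; `𝔩 k ∣ 𝔣 k`; `𝔣 k = 𝔪c k · v̄^{b k + 1}`, `1 ≤ b k`, `v ∤ 𝔪c k`,
`v̄ ∤ 𝔪c k` (the binders of `…TwoVariableMeasureDischargedSteps.exists_twoVariableMeasure_of_principal_split_steps`);
`𝔣 k ≠ 0`, `𝔣 (k+1) ⊆ 𝔣 k`; `𝔩 k ∈ S ∪ {v̄}` and every `w ∈ S ∪ {v̄}` occurs as `𝔩 k` beyond every bound;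
hence (`exists_le_prod_mul_pow_of_frequently`, `exists_prod_mul_pow_le_of_steps`) the chain is COFINAL with
the powers of `𝔤v̄` — `∀ m, ∃ n, 𝔣 n ⊆ (𝔤v̄)^m`, the `hcof` of
`iInter_diagonal_absRayAdicTower_subset_rayKer_of_finrank_eq_two` — and SUPPORTED on `S ∪ {v̄}` —
`∀ M, ∃ k, (𝔤v̄)^k ⊆ 𝔣 M`, the `hdiv` of `…_eq_rayKer_of_finrank_eq_two`.  De Shalit's compatible system
`𝔣 ∣ 𝔣'` of II.4.12 (ii) run one prime at a time through `𝔤𝔭̄^∞` (the pair `(𝔪c k, b k)` is built by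
recursion: a `v̄`-step raises `b`, an `S`-step multiplies `𝔪c`).
[cite: deShalit1987, II.4.12 (ii) (p. 67), II.4.14 Step 1 (p. 71), II.4.16 (p. 76)] -/
theorem exists_roundRobin_chain (S : Finset (HeightOneSpectrum (𝓞 K))) {v vbar : HeightOneSpectrum (𝓞 K)}
    (hvS : v ∉ S) (hvbarS : vbar ∉ S) :
    ∃ (𝔣 : ℕ → Ideal (𝓞 K)) (𝔩 : ℕ → HeightOneSpectrum (𝓞 K)) (𝔪c : ℕ → Ideal (𝓞 K)) (b : ℕ → ℕ),
      𝔣 0 = (∏ w ∈ S, w.asIdeal) * vbar.asIdeal ^ 2 ∧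
      (∀ k, 𝔣 (k + 1) = 𝔣 k * (𝔩 k).asIdeal) ∧
      (∀ k, (𝔩 k).asIdeal ∣ 𝔣 k) ∧
      (∀ k, 𝔣 k = 𝔪c k * vbar.asIdeal ^ (b k + 1)) ∧
      (∀ k, 1 ≤ b k) ∧
      (∀ k, ¬ 𝔪c k ≤ v.asIdeal) ∧
      (∀ k, ¬ 𝔪c k ≤ vbar.asIdeal) ∧
      (∀ k, 𝔣 k ≠ ⊥) ∧
      (∀ k, 𝔣 (k + 1) ≤ 𝔣 k) ∧
      (∀ k, 𝔩 k = vbar ∨ 𝔩 k ∈ S) ∧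
      (∀ w : HeightOneSpectrum (𝓞 K), (w = vbar ∨ w ∈ S) → ∀ N : ℕ, ∃ k, N ≤ k ∧ 𝔩 k = w) ∧
      (∀ m : ℕ, ∃ n, 𝔣 n ≤ ((∏ w ∈ S, w.asIdeal) * vbar.asIdeal) ^ m) ∧
      (∀ M : ℕ, ∃ k, ((∏ w ∈ S, w.asIdeal) * vbar.asIdeal) ^ k ≤ 𝔣 M) := by
  -- the round-robin step sequence through `insert vbar S`
  obtain ⟨𝔩, h𝔩mem, h𝔩freq⟩ := exists_roundRobin (insert vbar S) ⟨vbar, Finset.mem_insert_self vbar S⟩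
  have h𝔩 : ∀ k, 𝔩 k = vbar ∨ 𝔩 k ∈ S := fun k ↦ Finset.mem_insert.mp (h𝔩mem k)
  have h𝔩S : ∀ k, 𝔩 k ≠ vbar → 𝔩 k ∈ S := fun k hk ↦ (h𝔩 k).resolve_left hk
  -- the decomposition data `(𝔪c k, b k)` by recursion on `k`
  set 𝔤 : Ideal (𝓞 K) := ∏ w ∈ S, w.asIdeal with h𝔤
  have h𝔤v : ¬ 𝔤 ≤ v.asIdeal := not_prod_le_of_forall_ne S (fun w ↦ w) fun w hw hwv ↦ hvS (hwv ▸ hw)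
  have h𝔤vbar : ¬ 𝔤 ≤ vbar.asIdeal :=
    not_prod_le_of_forall_ne S (fun w ↦ w) fun w hw hwv ↦ hvbarS (hwv ▸ hw)
  have h𝔤0 : 𝔤 ≠ ⊥ := Finset.prod_ne_zero_iff.mpr fun w _ ↦ w.ne_bot
  set step : ℕ → Ideal (𝓞 K) × ℕ → Ideal (𝓞 K) × ℕ :=
    fun k ih ↦ if 𝔩 k = vbar then (ih.1, ih.2 + 1) else (ih.1 * (𝔩 k).asIdeal, ih.2) with hstep
  set P : ℕ → Ideal (𝓞 K) × ℕ := fun k ↦ @Nat.rec (fun _ ↦ Ideal (𝓞 K) × ℕ) (𝔤, 1) step k with hP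
  have hP0 : P 0 = (𝔤, 1) := rfl
  have hPs : ∀ k, P (k + 1) = step k (P k) := fun k ↦ rfl
  have hPs₁ : ∀ k, 𝔩 k = vbar → P (k + 1) = ((P k).1, (P k).2 + 1) := fun k hk ↦ by
    rw [hPs, hstep]; exact if_pos hk
  have hPs₂ : ∀ k, 𝔩 k ≠ vbar → P (k + 1) = ((P k).1 * (𝔩 k).asIdeal, (P k).2) := fun k hk ↦ by
    rw [hPs, hstep]; exact if_neg hk
  set 𝔣 : ℕ → Ideal (𝓞 K) := fun k ↦ (P k).1 * vbar.asIdeal ^ ((P k).2 + 1) with h𝔣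
  -- the step relation
  have hsucc : ∀ k, 𝔣 (k + 1) = 𝔣 k * (𝔩 k).asIdeal := by
    intro k
    by_cases hkv : 𝔩 k = vbar
    · show (P (k + 1)).1 * vbar.asIdeal ^ ((P (k + 1)).2 + 1) = (P k).1 * vbar.asIdeal ^ ((P k).2 + 1) * (𝔩 k).asIdeal
      rw [hPs₁ k hkv, hkv, pow_succ, mul_assoc]
    · show (P (k + 1)).1 * vbar.asIdeal ^ ((P (k + 1)).2 + 1) = (P k).1 * vbar.asIdeal ^ ((P k).2 + 1) * (𝔩 k).asIdeal
      rw [hPs₂ k hkv, mul_right_comm]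
  -- the invariants of the recursion
  have hinv : ∀ k, ¬ (P k).1 ≤ v.asIdeal ∧ ¬ (P k).1 ≤ vbar.asIdeal ∧ (P k).1 ≠ ⊥ ∧ 1 ≤ (P k).2 ∧ 𝔤 ∣ (P k).1 := by
    intro k
    induction k with
    | zero => exact ⟨h𝔤v, h𝔤vbar, h𝔤0, le_rfl, dvd_rfl⟩
    | succ k ih =>
      obtain ⟨h1, h2, h3, h4, h5⟩ := ih
      by_cases hkv : 𝔩 k = vbar
      · rw [hPs₁ k hkv]
        exact ⟨h1, h2, h3, h4.trans (Nat.le_succ _), h5⟩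
      · rw [hPs₂ k hkv]
        refine ⟨fun hle ↦ ?_, fun hle ↦ ?_, mul_ne_zero h3 (𝔩 k).ne_bot, h4, h5.mul_right _⟩
        · rcases (v.isPrime.mul_le).mp hle with h | h
          · exact h1 h
          · exact not_asIdeal_le_of_ne (w := 𝔩 k) (v := v) (fun heq ↦ hvS (by rw [← heq]; exact h𝔩S k hkv)) h
        · rcases (vbar.isPrime.mul_le).mp hle with h | h
          · exact h2 h
          · exact not_asIdeal_le_of_ne (w := 𝔩 k) (v := vbar) hkv h
  -- divisibility of the step prime
  have hdiv : ∀ k, (𝔩 k).asIdeal ∣ 𝔣 k := by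
    intro k
    show (𝔩 k).asIdeal ∣ (P k).1 * vbar.asIdeal ^ ((P k).2 + 1)
    by_cases hkv : 𝔩 k = vbar
    · rw [hkv]
      exact Dvd.dvd.mul_left (dvd_pow_self _ (Nat.succ_ne_zero _)) _
    · have h1 : (𝔩 k).asIdeal ∣ 𝔤 := Finset.dvd_prod_of_mem (fun w : HeightOneSpectrum (𝓞 K) ↦ w.asIdeal) (h𝔩S k hkv)
      have h2 : 𝔤 ∣ (P k).1 := (hinv k).2.2.2.2
      have h3 : (𝔩 k).asIdeal ∣ (P k).1 := dvd_trans h1 h2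
      exact Dvd.dvd.mul_right h3 _
  have h0 : ∀ k, 𝔣 k ≠ ⊥ := fun k ↦
    show (P k).1 * vbar.asIdeal ^ ((P k).2 + 1) ≠ ⊥ from mul_ne_zero (hinv k).2.2.1 (pow_ne_zero _ vbar.ne_bot)
  have hanti : ∀ k, 𝔣 (k + 1) ≤ 𝔣 k := fun k ↦ by rw [hsucc]; exact Ideal.mul_le_right
  have hfreq : ∀ w : HeightOneSpectrum (𝓞 K), (w = vbar ∨ w ∈ S) → ∀ N : ℕ, ∃ k, N ≤ k ∧ 𝔩 k = w :=
    fun w hw N ↦ h𝔩freq w (Finset.mem_insert.mpr hw) N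
  have hstart : 𝔣 0 = 𝔤 * vbar.asIdeal ^ 2 := by
    show (P 0).1 * vbar.asIdeal ^ ((P 0).2 + 1) = 𝔤 * vbar.asIdeal ^ 2
    rw [hP0]
  refine ⟨𝔣, 𝔩, fun k ↦ (P k).1, fun k ↦ (P k).2, hstart, hsucc, hdiv, fun k ↦ rfl, fun k ↦ (hinv k).2.2.2.1,
    fun k ↦ (hinv k).1, fun k ↦ (hinv k).2.1, h0, hanti, h𝔩, hfreq, ?_, ?_⟩
  · -- cofinality: every prime of `S ∪ {v̄}` is stepped infinitely often
    exact exists_le_prod_mul_pow_of_frequently S hanti hvbarS fun w hw N ↦ by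
      obtain ⟨k, hk, hkw⟩ := hfreq w hw N
      exact ⟨k, hk, by rw [hsucc, hkw]⟩
  · -- support: `(𝔤v̄)² ⊆ 𝔣_0 = 𝔤v̄²` and every step divides by a prime of `S ∪ {v̄}`
    refine exists_prod_mul_pow_le_of_steps S (k₀ := 2) ?_ fun k ↦ ⟨𝔩 k, h𝔩 k, (hsucc k).symm.le⟩
    rw [hstart, mul_pow]
    exact Ideal.mul_mono_left (Ideal.pow_le_self two_ne_zero)

/-! ### §4. The chain with `v̄` stepped LAST in each cycle: it passes through the uniform moduli
`(𝔤v̄)^{q+2} = modulusIdeal (insert v̄ S) (fun _ ↦ q + 1)` -/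

/-- ★★ **THE ROUND-ROBIN CHAIN THROUGH THE UNIFORM MODULI `𝔤^{M}v̄^{M}`.**  Same supply as
`exists_roundRobin_chain` (every clause repeated verbatim), for the cycle order "the primes of `S` (in a
fixed order), then `v̄`": started at `𝔤·v̄²` the exponent vector is `(v̄ : q+2, w : q+1)` at the start of
cycle `q`, the `|S|` steps through `S` raise it to the UNIFORM `(q+2, …, q+2)`, and the closing `v̄`-step
opens cycle `q+1`.  Hence the extra clause `∀ q, ∃ k, 𝔣 k = (𝔤v̄)^{q+2}` (namely `k = q(|S|+1) + |S|`):
the chain PASSES THROUGH every modulus `∏_{w ∈ S ∪ {v̄}} w^{M+1} = modulusIdeal (insert v̄ S) (fun _ ↦ M)`,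
`M ≥ 1` — the moduli at which the complex side of II.4.14 (36) (range decomposition, class sums of
Eisenstein numbers) is read — so the two-variable measure glued along this chain is read at exactly those
levels (de Shalit's `𝔣 = 𝔤𝔭̄^m` with the `𝔤`-power growing alongside, II.4.16).
[cite: deShalit1987, II.4.12 (ii) (p. 67), II.4.14 Step 1 (p. 71), II.4.16 (p. 76)] -/
theorem exists_roundRobin_chain_uniform (S : Finset (HeightOneSpectrum (𝓞 K)))
    {v vbar : HeightOneSpectrum (𝓞 K)} (hvS : v ∉ S) (hvbarS : vbar ∉ S) :
    ∃ (𝔣 : ℕ → Ideal (𝓞 K)) (𝔩 : ℕ → HeightOneSpectrum (𝓞 K)) (𝔪c : ℕ → Ideal (𝓞 K)) (b : ℕ → ℕ),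
      𝔣 0 = (∏ w ∈ S, w.asIdeal) * vbar.asIdeal ^ 2 ∧
      (∀ k, 𝔣 (k + 1) = 𝔣 k * (𝔩 k).asIdeal) ∧
      (∀ k, (𝔩 k).asIdeal ∣ 𝔣 k) ∧
      (∀ k, 𝔣 k = 𝔪c k * vbar.asIdeal ^ (b k + 1)) ∧
      (∀ k, 1 ≤ b k) ∧
      (∀ k, ¬ 𝔪c k ≤ v.asIdeal) ∧
      (∀ k, ¬ 𝔪c k ≤ vbar.asIdeal) ∧
      (∀ k, 𝔣 k ≠ ⊥) ∧
      (∀ k, 𝔣 (k + 1) ≤ 𝔣 k) ∧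
      (∀ k, 𝔩 k = vbar ∨ 𝔩 k ∈ S) ∧
      (∀ w : HeightOneSpectrum (𝓞 K), (w = vbar ∨ w ∈ S) → ∀ N : ℕ, ∃ k, N ≤ k ∧ 𝔩 k = w) ∧
      (∀ m : ℕ, ∃ n, 𝔣 n ≤ ((∏ w ∈ S, w.asIdeal) * vbar.asIdeal) ^ m) ∧
      (∀ M : ℕ, ∃ k, ((∏ w ∈ S, w.asIdeal) * vbar.asIdeal) ^ k ≤ 𝔣 M) ∧
      (∀ q : ℕ, ∃ k, 𝔣 k = ((∏ w ∈ S, w.asIdeal) * vbar.asIdeal) ^ (q + 2)) := by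
  -- the step sequence: the primes of `S` in the order of `S.equivFin`, then `v̄`, repeated
  set s : ℕ := S.card with hs
  set e := S.equivFin with he
  set w : ℕ → HeightOneSpectrum (𝓞 K) := fun i ↦ if h : i < s then ((e.symm ⟨i, h⟩ : S) : _) else vbar
    with hw
  set 𝔩 : ℕ → HeightOneSpectrum (𝓞 K) := fun k ↦ w (k % (s + 1)) with h𝔩def
  have hwS : ∀ i, i < s → w i ∈ S := fun i hi ↦ by
    simp only [hw, dif_pos hi]; exact (e.symm ⟨i, hi⟩).2
  have hwv : ∀ i, ¬ i < s → w i = vbar := fun i hi ↦ by simp only [hw, dif_neg hi]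
  have h𝔩 : ∀ k, 𝔩 k = vbar ∨ 𝔩 k ∈ S := fun k ↦ by
    by_cases h : k % (s + 1) < s
    · exact Or.inr (hwS _ h)
    · exact Or.inl (hwv _ h)
  have h𝔩S : ∀ k, 𝔩 k ≠ vbar → 𝔩 k ∈ S := fun k hk ↦ (h𝔩 k).resolve_left hk
  have hmodr : ∀ q r, r < s + 1 → (r + (s + 1) * q) % (s + 1) = r := fun q r hr ↦ by
    rw [Nat.add_mul_mod_self_left, Nat.mod_eq_of_lt hr]
  have h𝔩r : ∀ q r (hr : r < s), 𝔩 (r + (s + 1) * q) = ((e.symm ⟨r, hr⟩ : S) : HeightOneSpectrum (𝓞 K)) :=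
    fun q r hr ↦ by
      show w ((r + (s + 1) * q) % (s + 1)) = _
      rw [hmodr q r (hr.trans (Nat.lt_succ_self s)), hw]
      exact dif_pos hr
  have h𝔩last : ∀ q, 𝔩 (s + (s + 1) * q) = vbar := fun q ↦ by
    show w ((s + (s + 1) * q) % (s + 1)) = vbar
    rw [hmodr q s (Nat.lt_succ_self s)]
    exact hwv s (lt_irrefl s)
  have hfreq : ∀ w₀ : HeightOneSpectrum (𝓞 K), (w₀ = vbar ∨ w₀ ∈ S) → ∀ N : ℕ, ∃ k, N ≤ k ∧ 𝔩 k = w₀ := by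
    intro w₀ hw₀ N
    have hN : ∀ r, N ≤ r + (s + 1) * N := fun r ↦
      (Nat.le_mul_of_pos_left N (Nat.succ_pos s)).trans (Nat.le_add_left _ _)
    rcases hw₀ with rfl | hw₀
    · exact ⟨s + (s + 1) * N, hN s, h𝔩last N⟩
    · refine ⟨(e ⟨w₀, hw₀⟩ : ℕ) + (s + 1) * N, hN _, ?_⟩
      rw [h𝔩r N _ (e ⟨w₀, hw₀⟩).2, Fin.eta, Equiv.symm_apply_apply]
  -- the cycle product `∏_{r < s} w r = 𝔤`
  set 𝔤 : Ideal (𝓞 K) := ∏ w ∈ S, w.asIdeal with h𝔤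
  have hprod : ∏ i ∈ Finset.range s, (w i).asIdeal = 𝔤 := by
    rw [Finset.prod_range (fun i ↦ (w i).asIdeal)]
    have h1 : ∀ i : Fin s, (w i).asIdeal = ((e.symm i : S) : HeightOneSpectrum (𝓞 K)).asIdeal := fun i ↦ by
      rw [hw]; simp only [dif_pos i.2, Fin.eta]
    rw [Fintype.prod_congr _ _ h1,
      e.symm.prod_comp (fun x : S ↦ (x : HeightOneSpectrum (𝓞 K)).asIdeal), h𝔤, ← Finset.prod_coe_sort S]
  -- the recursion (verbatim as in `exists_roundRobin_chain`)
  have h𝔤v : ¬ 𝔤 ≤ v.asIdeal := not_prod_le_of_forall_ne S (fun w ↦ w) fun w hw hwv ↦ hvS (hwv ▸ hw)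
  have h𝔤vbar : ¬ 𝔤 ≤ vbar.asIdeal :=
    not_prod_le_of_forall_ne S (fun w ↦ w) fun w hw hwv ↦ hvbarS (hwv ▸ hw)
  have h𝔤0 : 𝔤 ≠ ⊥ := Finset.prod_ne_zero_iff.mpr fun w _ ↦ w.ne_bot
  set step : ℕ → Ideal (𝓞 K) × ℕ → Ideal (𝓞 K) × ℕ :=
    fun k ih ↦ if 𝔩 k = vbar then (ih.1, ih.2 + 1) else (ih.1 * (𝔩 k).asIdeal, ih.2) with hstep
  set P : ℕ → Ideal (𝓞 K) × ℕ := fun k ↦ @Nat.rec (fun _ ↦ Ideal (𝓞 K) × ℕ) (𝔤, 1) step k with hP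
  have hP0 : P 0 = (𝔤, 1) := rfl
  have hPs : ∀ k, P (k + 1) = step k (P k) := fun k ↦ rfl
  have hPs₁ : ∀ k, 𝔩 k = vbar → P (k + 1) = ((P k).1, (P k).2 + 1) := fun k hk ↦ by
    rw [hPs, hstep]; exact if_pos hk
  have hPs₂ : ∀ k, 𝔩 k ≠ vbar → P (k + 1) = ((P k).1 * (𝔩 k).asIdeal, (P k).2) := fun k hk ↦ by
    rw [hPs, hstep]; exact if_neg hk
  set 𝔣 : ℕ → Ideal (𝓞 K) := fun k ↦ (P k).1 * vbar.asIdeal ^ ((P k).2 + 1) with h𝔣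
  have hsucc : ∀ k, 𝔣 (k + 1) = 𝔣 k * (𝔩 k).asIdeal := by
    intro k
    by_cases hkv : 𝔩 k = vbar
    · show (P (k + 1)).1 * vbar.asIdeal ^ ((P (k + 1)).2 + 1) = (P k).1 * vbar.asIdeal ^ ((P k).2 + 1) * (𝔩 k).asIdeal
      rw [hPs₁ k hkv, hkv, pow_succ, mul_assoc]
    · show (P (k + 1)).1 * vbar.asIdeal ^ ((P (k + 1)).2 + 1) = (P k).1 * vbar.asIdeal ^ ((P k).2 + 1) * (𝔩 k).asIdeal
      rw [hPs₂ k hkv, mul_right_comm]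
  have hinv : ∀ k, ¬ (P k).1 ≤ v.asIdeal ∧ ¬ (P k).1 ≤ vbar.asIdeal ∧ (P k).1 ≠ ⊥ ∧ 1 ≤ (P k).2 ∧ 𝔤 ∣ (P k).1 := by
    intro k
    induction k with
    | zero => exact ⟨h𝔤v, h𝔤vbar, h𝔤0, le_rfl, dvd_rfl⟩
    | succ k ih =>
      obtain ⟨h1, h2, h3, h4, h5⟩ := ih
      by_cases hkv : 𝔩 k = vbar
      · rw [hPs₁ k hkv]
        exact ⟨h1, h2, h3, h4.trans (Nat.le_succ _), h5⟩
      · rw [hPs₂ k hkv]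
        refine ⟨fun hle ↦ ?_, fun hle ↦ ?_, mul_ne_zero h3 (𝔩 k).ne_bot, h4, h5.mul_right _⟩
        · rcases (v.isPrime.mul_le).mp hle with h | h
          · exact h1 h
          · exact not_asIdeal_le_of_ne (w := 𝔩 k) (v := v) (fun heq ↦ hvS (by rw [← heq]; exact h𝔩S k hkv)) h
        · rcases (vbar.isPrime.mul_le).mp hle with h | h
          · exact h2 h
          · exact not_asIdeal_le_of_ne (w := 𝔩 k) (v := vbar) hkv h
  have hdiv : ∀ k, (𝔩 k).asIdeal ∣ 𝔣 k := by
    intro k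
    show (𝔩 k).asIdeal ∣ (P k).1 * vbar.asIdeal ^ ((P k).2 + 1)
    by_cases hkv : 𝔩 k = vbar
    · rw [hkv]
      exact Dvd.dvd.mul_left (dvd_pow_self _ (Nat.succ_ne_zero _)) _
    · have h1 : (𝔩 k).asIdeal ∣ 𝔤 := Finset.dvd_prod_of_mem (fun w : HeightOneSpectrum (𝓞 K) ↦ w.asIdeal) (h𝔩S k hkv)
      have h2 : 𝔤 ∣ (P k).1 := (hinv k).2.2.2.2
      have h3 : (𝔩 k).asIdeal ∣ (P k).1 := dvd_trans h1 h2
      exact Dvd.dvd.mul_right h3 _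
  have h0 : ∀ k, 𝔣 k ≠ ⊥ := fun k ↦
    show (P k).1 * vbar.asIdeal ^ ((P k).2 + 1) ≠ ⊥ from mul_ne_zero (hinv k).2.2.1 (pow_ne_zero _ vbar.ne_bot)
  have hanti : ∀ k, 𝔣 (k + 1) ≤ 𝔣 k := fun k ↦ by rw [hsucc]; exact Ideal.mul_le_right
  have hstart : 𝔣 0 = 𝔤 * vbar.asIdeal ^ 2 := by
    show (P 0).1 * vbar.asIdeal ^ ((P 0).2 + 1) = 𝔤 * vbar.asIdeal ^ 2
    rw [hP0]
  -- the state along a cycle: `P (q(s+1)) = (𝔤^{q+1}, q+1)` and `P (q(s+1) + r) = (𝔤^{q+1}·∏_{i<r} w i, q+1)`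
  have hB : ∀ q, P ((s + 1) * q) = (𝔤 ^ (q + 1), q + 1) → ∀ r, r ≤ s →
      P (r + (s + 1) * q) = (𝔤 ^ (q + 1) * ∏ i ∈ Finset.range r, (w i).asIdeal, q + 1) := by
    intro q hq r
    induction r with
    | zero => intro _; rw [Nat.zero_add, hq, Finset.range_zero, Finset.prod_empty, mul_one]
    | succ r ih =>
      intro hr
      have hr' : r < s := Nat.lt_of_succ_le hr
      have hk : r + 1 + (s + 1) * q = r + (s + 1) * q + 1 := by ring
      have h𝔩k : 𝔩 (r + (s + 1) * q) = w r := by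
        rw [h𝔩r q r hr']
        show _ = (fun i ↦ if h : i < s then ((e.symm ⟨i, h⟩ : S) : HeightOneSpectrum (𝓞 K)) else vbar) r
        simp only [dif_pos hr']
      have hne : 𝔩 (r + (s + 1) * q) ≠ vbar := fun h ↦ hvbarS (h ▸ h𝔩k ▸ hwS r hr')
      rw [hk, hPs₂ _ hne, ih hr'.le, h𝔩k, Finset.prod_range_succ, mul_assoc]
  have hA : ∀ q, P ((s + 1) * q) = (𝔤 ^ (q + 1), q + 1) := by
    intro q
    induction q with
    | zero => rw [mul_zero, hP0, zero_add, pow_one]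
    | succ q ih =>
      have hk : (s + 1) * (q + 1) = s + (s + 1) * q + 1 := by ring
      rw [hk, hPs₁ _ (h𝔩last q), hB q ih s le_rfl, hprod, ← pow_succ]
  refine ⟨𝔣, 𝔩, fun k ↦ (P k).1, fun k ↦ (P k).2, hstart, hsucc, hdiv, fun k ↦ rfl, fun k ↦ (hinv k).2.2.2.1,
    fun k ↦ (hinv k).1, fun k ↦ (hinv k).2.1, h0, hanti, h𝔩, hfreq, ?_, ?_, fun q ↦ ⟨s + (s + 1) * q, ?_⟩⟩
  · exact exists_le_prod_mul_pow_of_frequently S hanti hvbarS fun w hw N ↦ by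
      obtain ⟨k, hk, hkw⟩ := hfreq w hw N
      exact ⟨k, hk, by rw [hsucc, hkw]⟩
  · refine exists_prod_mul_pow_le_of_steps S (k₀ := 2) ?_ fun k ↦ ⟨𝔩 k, h𝔩 k, (hsucc k).symm.le⟩
    rw [hstart, mul_pow]
    exact Ideal.mul_mono_left (Ideal.pow_le_self two_ne_zero)
  · -- `𝔣 (q(s+1) + s) = 𝔤^{q+1}·𝔤·v̄^{q+2} = (𝔤v̄)^{q+2}`
    show (P (s + (s + 1) * q)).1 * vbar.asIdeal ^ ((P (s + (s + 1) * q)).2 + 1) = (𝔤 * vbar.asIdeal) ^ (q + 2)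
    rw [hB q (hA q) s le_rfl, hprod, ← pow_succ, mul_pow]

omit [NumberField K] in
/-- **The uniform moduli of the chain are the lane's `modulusIdeal`s**: for `v̄ ∉ S`,
`(∏_{w∈S} w · v̄)^{q+2} = ∏_{w ∈ S ∪ {v̄}} w^{(q+1)+1} = modulusIdeal (insert v̄ S) (fun _ ↦ q + 1)` — the
modulus `𝔪_M`, `M = q + 1`, at which the range decomposition and the class sums of Eisenstein numbers are
read (de Shalit's `𝔤^{M+1}𝔭̄^{M+1}`). [cite: deShalit1987, II.4.14 (36) (p. 71), II.4.16 (p. 76)] -/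
theorem prod_mul_pow_eq_modulusIdeal (S : Finset (HeightOneSpectrum (𝓞 K))) {vbar : HeightOneSpectrum (𝓞 K)}
    (hvbarS : vbar ∉ S) (q : ℕ) :
    ((∏ w ∈ S, w.asIdeal) * vbar.asIdeal) ^ (q + 2) =
      Literature.NumberTheory.GaloisRepresentations.HeckeCharacter.modulusIdeal (insert vbar S) (fun _ ↦ q + 1) := by
  rw [Literature.NumberTheory.GaloisRepresentations.HeckeCharacter.modulusIdeal, Finset.prod_insert hvbarS,
    Finset.prod_pow, mul_pow, mul_comm]

end DeShalit1987

end Literature.NumberTheory.EllipticCurves
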